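import Summits.QuantumFields.YangMills.Theorems.UnitScaleTiltProp7CornerCombH21ETiedLevelRows
import Summits.QuantumFields.YangMills.Theorems.UnitScaleTiltProp7CornerCombH21ELevelZeroRows
import Summits.QuantumFields.YangMills.Theorems.UnitScaleTiltProp7CornerCombH21ERealAssembly
import HarnessLib

/-!
# (n3)-COMB (II), row `hMcomb₂`, H2-1(E) member knit, file M-3 (proper) part 3 «THE KNIT FROM ROWS» — THE H2-1(E) `ℓ¹` KNIT ON `ℤ³` ASSEMBLED FROM DISPLAYED ROWS:
# Duhamel row + per-level tied rows + the level-0 row + the `hMcomb` ∕ (G_j) currencies ⟹ `Σ_{cell}‖E_l‖ ≤ Am₂·(Lˡ)⁻¹ + Bm₂·Lˡ` by ✓`h21E_real_assembly`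

Crux `stmt-QuantumFields-19200` `Summit.QuantumFields.YangMills.Theses.UnitScaleTilt.MinimiserStabilityRegPr`, route-R E′ (A′)-on-Σ, P-A2 (β); row `hMcomb₂` ⟸ H2-1(E)
(★px17 H-3c ✓p714849 ∕ H-4b: `hMcomb₂` ⟸ per-(l, j) `ℓ¹` bounds of the cornered propagators on tied sources + the level-0 defect).  px18 g4 LOCATE «H2-1(E) SUPPLIER — THE MEMBER
KNIT SKELETON OVER THE LANDED ℓ¹ KIT» (19200 evidence 2686e4bb) §2 «M-3»; seam (β) with ★px17 g5 (the MEMBER instantiation at `RegPr` is M-4b, not here); v2 after ★px17 g5's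
located `(1 + N_l³)` volume leak (bus 2026-08-29 11:25:01Z): the Λ boxes are priced with the UNIFORM big box `Rb := s·(L+4)` (`s` = corner spacing) and counted over the corner
FAMILY with bounded multiplicity (✓F-6d-1), so every currency is extensive ONCE.  Cell `ym3-torus`, width seat `ym-ust-20520-w3` (gen 12);
`--kind proof --supports stmt-QuantumFields-19200 --as helper`; THEOREMS ONLY (0 `def`, 0 `sorry`); «(O2) groundwork»; count-neutral.

THE POINT.  ★px17's H-4b turns the second-order defect tower `E_l` into `P_{l←0}(E_0) + Σ_{j<l} P_{l←j+1}(s_j)` with TIED sources; parts 1–2 price each term in the monomials of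
★routeR-w3's ✓p714406 `h21E_real_assembly`; this file is the one `exact`: ALL families abstract on `ℤᵈ` (`d = 3`) — the defect `El`, the level-0 background∕loops∕tower∕source
`U₀ α₀ Q0 Y0` dominated by `X♯`, and for every source level `j < l` the RE-BASED background `Ub j`, loops `αj j`, tower `Qj j`, source `sj j` tied to the `Nj j`-periodic
`Yj j` (M-4b instantiates `Ub j := Ū⁽ʲ⁺¹⁾♯`, `Qj j k := P (j+1+k) (j+1)` by M-1 ★`avgIter_add`); ONE window-product constant `E`; the DUHAMEL ROW `hDuh` (✓H-4
`sum_norm_le_of_duhamel₂`'s output summed over `box c R × Fin d`); the currencies `hMc` (`hMcomb` shape), `hGc` ((G_j), B-slot, NO volume factor), `hMX`, `hGX`.  CONCLUSION: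
`Σ_{z∈box c R}Σ_κ‖El z κ‖ ≤ Am₂·(Lˡ)⁻¹ + Bm₂·Lˡ` with `Am₂ Bm₂` written out, closed in `(L, Cs, c₀, E, Am, Bm, Bg, M, G₀)` (✓`h21E_real_assembly`'s constants at
`cS := 4374·Cs + 729·c₀`, `cΛ := (1728·Cs + 288·c₀)·L·(2L+9)³`, `V := 1`, `V′ := 13068(L+4)²`) — the `hEcell` socket of ★px17 g5's M-4a up to the member dictionary (M-4b).

WHAT IS PROVED (ns `…Theorems.Prop7CornerCombH21EOfRows`): ★★★ `h21E_of_rows`.  Decl-local heartbeat budget 400000 (README HEARTBEAT rule; measured: > 100k).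

HONEST SCOPE.  Finite-sum ∕ real-inequality bookkeeping over landed and signed rows; every analytic input is a displayed hypothesis.  Nothing of H2-1's member,
`hMcomb₂`, `hMcomb`, (G_j), (β), `hD`, EX `stub_existenceMinimalOrbit`, the crux `MinimiserStabilityRegPr`, or any summit statement is proved or claimed here.
YM₃ on T³ is ladder rung R3 (HUMAN RULING D-0037) — NOT d = 4, NOT infinite volume, NOT a mass gap, NOT the Clay problem; the YM mass gap is NOT proved.

References: T. Bałaban, «Averaging operations for lattice gauge theories», CMP **98** (1985) 17–51 [Balaban1985Averaging] ((2) p.17, (42)–(43) pp.23–24, (124)–(126) p.36);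
T. Bałaban, «The variational problem and background fields in renormalization group method for lattice gauge theories», CMP **102** (1985) 277–309 [Balaban1985Variational] (Prop. 7 p.299);
M. Giaquinta, *Multiple integrals in the calculus of variations and nonlinear elliptic systems* (1983) [Giaquinta1984] (Ch. III §1 pp.64–72).
-/

set_option autoImplicit false

noncomputable section

open scoped BigOperators
open Finset

namespace Summit.QuantumFields.YangMills.Theorems.Prop7CornerCombH21EOfRows

open NormedSpace
open Literature.MathematicalPhysics.QuantumFieldTheory.Balaban1983to89
open ExpMeanLog (eml)
open B7Prop1Explicit (Site Letter e seg treeWord boxVec gammaWord Wcx Xavg bavg expUnit U1)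
open B7Prop2Explicit (avgIter unitaryUnits)
open B7Prop3GeneralRotated (tsum)
open B4Eq19LatticeOperators (box)
open Summit.QuantumFields.YangMills.Theorems.Prop7CornerCombH21ETiedLevelRows (sum_norm_linTower_tied_le_rows)
open Summit.QuantumFields.YangMills.Theorems.Prop7CornerCombH21ELevelZeroRows (sum_norm_linTower_sq_le_rows)
open Summit.QuantumFields.YangMills.Theorems.Prop7CornerCombH21ERealAssembly (h21E_real_assembly)

variable {d : ℕ} {𝔸 : Type*} [CStarAlgebra 𝔸] [Nontrivial 𝔸] {𝔅 : Type*} [SeminormedAddCommGroup 𝔅]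

-- hb 400000: large displayed binders (the written-out cornered tower recursion) + instantiation of the M-1∕M-2∕M-3-R rows; measured > 100k, < 200k.
set_option maxHeartbeats 400000 in
/-- ★★★ **THE H2-1(E) `ℓ¹` KNIT ON `ℤ³`, FROM DISPLAYED ROWS** (`d = 3`, `2 ≤ L`; all families ABSTRACT — no torus, no `RegPr`).
DATA per reading level `l` (period `N_l ≥ 1`, reading set `box c R ⊇` one period cell, `2R+1 ≤ 2N_l`): an abstract defect family `El`; the LEVEL-0 term — background `U₀`
with loops `α₀` (unitary through level `l`, loops `≤ α₀ ≤ 1∕24`), the cornered linearised tower `Q0` of a source `Y0` SQUARE-DOMINATED by the `N₀`-periodic `X♯`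
(`‖Y0‖ ≤ c₀‖X♯‖²`, `N₀ = N_l·Lˡ`); for every SOURCE LEVEL `j < l` (with `n := l−1−j`) — a RE-BASED background `Ub j` with loops `αj j`, the tower `Qj j` of the source `sj j`
TIED (constant `Cs`) to the `Nj j`-periodic field `Yj j` (`Nj j = N_l·L^{n+1}`); ONE window-product constant `E` for all of them (`Π_{m<i} w ≤ E·((L²)^i)⁻¹`); the
DUHAMEL ROW `hDuh : Σ‖El‖ ≤ Σ‖Q0 l Y0‖ + Σ_{j<l}Σ‖Qj j n (sj j)‖` (✓H-4 `sum_norm_le_of_duhamel₂`'s output, summed over `box c R × Fin d`); and the CURRENCIES: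
`hMc : Σ_{cell}‖Yj j‖² ≤ Am·(Lʲ)⁻¹ + Bm·Lʲ` (`hMcomb`), `hGc : NORMGAPcell(Yj j) ≤ Bg·Lʲ` ((G_j), B-slot — extensive ONCE, no volume factor: ★px17 g5's located leak, repaired by the corner-family count), `hMX : Σ_{cell}‖X♯‖² ≤ M`, `hGX : NORMGAPcell(X♯) ≤ G₀`.
CONCLUSION: `Σ_{z∈box c R}Σ_κ‖El z κ‖ ≤ Am₂·(Lˡ)⁻¹ + Bm₂·Lˡ` with `Am₂`, `Bm₂` CLOSED in `(L, Cs, c₀, E, Am, Bm, Bg, M, G₀)` — ✓`h21E_real_assembly`'s constants at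
`cS := 4374·Cs + 729·c₀`, `cΛ := (1728·Cs + 288·c₀)·L·(2L+9)³`, `V := 1`, `V′ := 13068(L+4)²`.  Proof: `hDuh`, §2 on the level-0 term, §1 on each source level, then
`h21E_real_assembly` with `S j`∕`Λ j`∕`Z₀` := the §1∕§2 right-hand sides.  «(O2) groundwork» — the member (M-4b: `U₀ := Ū⁽ʲ⁺¹⁾♯`, `Qj j k := P (j+1+k) (j+1)`, windows,
✓F-8a periodicity, H-4b) is NOT here. [cite: Balaban1985Averaging, (42)-(43) pp.23-24, (124)-(126) p.36; Balaban1985Variational, Prop. 7 p.299] -/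
theorem h21E_of_rows (hd : d = 3) (L : ℕ) (hL : 2 ≤ L) (l : ℕ) (Nl : ℕ) (hNl : 1 ≤ Nl) (c : Site d) (R : ℕ) (hR : 2 * R + 1 ≤ 2 * Nl)
    {E Cs c₀ Am Bm Bg M G₀ : ℝ} (hE : 0 ≤ E) (hCs : 0 ≤ Cs) (hc₀ : 0 ≤ c₀) (hAm : 0 ≤ Am) (hBm : 0 ≤ Bm) (hBg : 0 ≤ Bg)
    (El : Site d → Fin d → 𝔸)
    -- the level-0 term
    (U₀ : Site d → Fin d → 𝔸ˣ) (α₀ : ℕ → ℝ)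
    (hV₀ : ∀ k, k ≤ l → ∀ (x : Site d) (μ : Fin d), avgIter L U₀ k x μ ∈ unitaryUnits 𝔸)
    (hα₀0 : ∀ k, 0 ≤ α₀ k)
    (hα₀ : ∀ k, k < l → ∀ (z : Site d) (κ : Fin d) (r : Fin d → Fin L),
      ‖((Wcx L (avgIter L U₀ k) ((L : ℤ) • z) κ (boxVec L r) : 𝔸ˣ) : 𝔸) - 1‖ ≤ α₀ k)
    (hα₀24 : ∀ k, k < l → α₀ k ≤ 1 / 24)
    (hprod₀ : ∀ i, i ≤ l →
      ∏ m ∈ Finset.range i, ((L : ℝ) * ((L : ℝ) ^ d)⁻¹ + 2 * d * (210 * α₀ m * ((2 * d + 2) * L))) ≤ E * (((L : ℝ) ^ 2) ^ i)⁻¹)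
    (Y0 : Site d → Fin d → 𝔸) (Q0 : ℕ → (Site d → Fin d → 𝔸) → Site d → Fin d → 𝔸) (hQ00 : Q0 0 Y0 = Y0)
    (hQ0s : ∀ (k : ℕ) (z : Site d) (κ : Fin d), Q0 (k + 1) Y0 z κ
      = fderiv ℂ (eml : ((Fin d → Fin L) → 𝔸) → 𝔸) (fun r => ((Wcx L (avgIter L U₀ k) ((L : ℤ) • z) κ (boxVec L r) : 𝔸ˣ) : 𝔸))
            (fun r => tsum (avgIter L U₀ k) (Q0 k Y0) ((L : ℤ) • z) (gammaWord L κ (boxVec L r) ++ seg κ (-(L : ℤ)))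
              * ((Wcx L (avgIter L U₀ k) ((L : ℤ) • z) κ (boxVec L r) : 𝔸ˣ) : 𝔸))
            * (((expUnit (Xavg L (avgIter L U₀ k) ((L : ℤ) • z) κ))⁻¹ : 𝔸ˣ) : 𝔸)
          + ((expUnit (Xavg L (avgIter L U₀ k) ((L : ℤ) • z) κ) : 𝔸ˣ) : 𝔸) * tsum (avgIter L U₀ k) (Q0 k Y0) ((L : ℤ) • z) (seg κ (L : ℤ))
            * (((expUnit (Xavg L (avgIter L U₀ k) ((L : ℤ) • z) κ))⁻¹ : 𝔸ˣ) : 𝔸))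
    (Xf : Site d → Fin d → 𝔅) (hY0 : ∀ (x : Site d) (μ : Fin d), ‖Y0 x μ‖ ≤ c₀ * ‖Xf x μ‖ ^ 2)
    (N0 : ℕ) [NeZero N0] (hper0 : ∀ (x : Site d) (κ : Fin d), Xf (x + (N0 : ℤ) • e κ) = Xf x) (hN0 : N0 = Nl * L ^ l)
    (hMX : ∑ y : Fin d → Fin N0, ∑ ν : Fin d, ‖Xf (boxVec N0 y) ν‖ ^ 2 ≤ M)
    (hGX : ∑ y : Fin d → Fin N0, ∑ ν : Fin d, ∑ μ : Fin d, (‖Xf (boxVec N0 y + e μ) ν‖ - ‖Xf (boxVec N0 y) ν‖) ^ 2 ≤ G₀)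
    -- the source levels `j < l` (re-based data, `n := l - 1 - j`)
    (Ub : ℕ → Site d → Fin d → 𝔸ˣ) (αj : ℕ → ℕ → ℝ)
    (hVj : ∀ j, j < l → ∀ k, k ≤ l - 1 - j → ∀ (x : Site d) (μ : Fin d), avgIter L (Ub j) k x μ ∈ unitaryUnits 𝔸)
    (hαj0 : ∀ j k, 0 ≤ αj j k)
    (hαj : ∀ j, j < l → ∀ k, k < l - 1 - j → ∀ (z : Site d) (κ : Fin d) (r : Fin d → Fin L),
      ‖((Wcx L (avgIter L (Ub j) k) ((L : ℤ) • z) κ (boxVec L r) : 𝔸ˣ) : 𝔸) - 1‖ ≤ αj j k)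
    (hαj24 : ∀ j, j < l → ∀ k, k < l - 1 - j → αj j k ≤ 1 / 24)
    (hprodj : ∀ j, j < l → ∀ i, i ≤ l - 1 - j →
      ∏ m ∈ Finset.range i, ((L : ℝ) * ((L : ℝ) ^ d)⁻¹ + 2 * d * (210 * αj j m * ((2 * d + 2) * L))) ≤ E * (((L : ℝ) ^ 2) ^ i)⁻¹)
    (sj : ℕ → Site d → Fin d → 𝔸) (Qj : ℕ → ℕ → (Site d → Fin d → 𝔸) → Site d → Fin d → 𝔸) (hQj0 : ∀ j, Qj j 0 (sj j) = sj j)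
    (hQjs : ∀ j, j < l → ∀ (k : ℕ) (z : Site d) (κ : Fin d), Qj j (k + 1) (sj j) z κ
      = fderiv ℂ (eml : ((Fin d → Fin L) → 𝔸) → 𝔸) (fun r => ((Wcx L (avgIter L (Ub j) k) ((L : ℤ) • z) κ (boxVec L r) : 𝔸ˣ) : 𝔸))
            (fun r => tsum (avgIter L (Ub j) k) (Qj j k (sj j)) ((L : ℤ) • z) (gammaWord L κ (boxVec L r) ++ seg κ (-(L : ℤ)))
              * ((Wcx L (avgIter L (Ub j) k) ((L : ℤ) • z) κ (boxVec L r) : 𝔸ˣ) : 𝔸))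
            * (((expUnit (Xavg L (avgIter L (Ub j) k) ((L : ℤ) • z) κ))⁻¹ : 𝔸ˣ) : 𝔸)
          + ((expUnit (Xavg L (avgIter L (Ub j) k) ((L : ℤ) • z) κ) : 𝔸ˣ) : 𝔸) * tsum (avgIter L (Ub j) k) (Qj j k (sj j)) ((L : ℤ) • z) (seg κ (L : ℤ))
            * (((expUnit (Xavg L (avgIter L (Ub j) k) ((L : ℤ) • z) κ))⁻¹ : 𝔸ˣ) : 𝔸))
    (Yj : ℕ → Site d → Fin d → 𝔅)
    (hsj : ∀ j, j < l → ∀ (y : Site d) (κ : Fin d), ‖sj j y κ‖ ≤ Cs * ∑ σ : Fin d → Fin L, ∑ ν : Fin d,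
      (‖Yj j ((L : ℤ) • y + boxVec L σ) ν‖ ^ 2 + ‖Yj j ((L : ℤ) • y + (L : ℤ) • e κ + boxVec L σ) ν‖ ^ 2))
    (Nj : ℕ → ℕ) [∀ j, NeZero (Nj j)] (hperj : ∀ j, j < l → ∀ (x : Site d) (κ : Fin d), Yj j (x + (Nj j : ℤ) • e κ) = Yj j x)
    (hNj : ∀ j, j < l → Nj j = Nl * L ^ (l - 1 - j + 1))
    (hMc : ∀ j, j < l → ∑ y : Fin d → Fin (Nj j), ∑ ν : Fin d, ‖Yj j (boxVec (Nj j) y) ν‖ ^ 2 ≤ Am * ((L : ℝ) ^ j)⁻¹ + Bm * (L : ℝ) ^ j)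
    (hGc : ∀ j, j < l →
      ∑ y : Fin d → Fin (Nj j), ∑ ν : Fin d, ∑ μ : Fin d, (‖Yj j (boxVec (Nj j) y + e μ) ν‖ - ‖Yj j (boxVec (Nj j) y) ν‖) ^ 2 ≤ Bg * (L : ℝ) ^ j)
    -- the Duhamel row
    (hDuh : ∑ z ∈ box c (R : ℤ), ∑ κ : Fin d, ‖El z κ‖ ≤
      ∑ z ∈ box c (R : ℤ), ∑ κ : Fin d, ‖Q0 l Y0 z κ‖ + ∑ j ∈ Finset.range l, ∑ z ∈ box c (R : ℤ), ∑ κ : Fin d, ‖Qj j (l - 1 - j) (sj j) z κ‖) :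
    ∑ z ∈ box c (R : ℤ), ∑ κ : Fin d, ‖El z κ‖ ≤
      E * ((4374 * Cs + 729 * c₀) + (1728 * Cs + 288 * c₀) * L * (2 * (L : ℝ) + 9) ^ 3 * 1 / ((L : ℝ) - 1)) * (Am * ((L : ℝ) ^ 2 / ((L : ℝ) - 1)) + M)
          * ((L : ℝ) ^ l)⁻¹
        + (E * ((4374 * Cs + 729 * c₀) + (1728 * Cs + 288 * c₀) * L * (2 * (L : ℝ) + 9) ^ 3 * 1 / ((L : ℝ) - 1)) * Bm * ((L : ℝ) ^ 2 / ((L : ℝ) ^ 3 - 1))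
            + E * ((1728 * Cs + 288 * c₀) * L * (2 * (L : ℝ) + 9) ^ 3) * (13068 * ((L : ℝ) + 4) ^ 2) * (L : ℝ) ^ 2 * (Bg / ((L : ℝ) - 1) ^ 2 + G₀))
          * (L : ℝ) ^ l := by
  -- the four constant slots
  set cS : ℝ := 4374 * Cs + 729 * c₀ with hcS
  set cΛ : ℝ := (1728 * Cs + 288 * c₀) * L * (2 * (L : ℝ) + 9) ^ 3 with hcΛ
  set V : ℝ := (1 : ℝ) with hV
  set V' : ℝ := 13068 * ((L : ℝ) + 4) ^ 2 with hV'
  have hLr : (2 : ℝ) ≤ L := by exact_mod_cast hL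
  have hL9 : (0 : ℝ) ≤ (L : ℝ) * (2 * (L : ℝ) + 9) ^ 3 := by positivity
  have hcS1 : 4374 * Cs ≤ cS := by rw [hcS]; linarith [mul_nonneg (by norm_num : (0:ℝ) ≤ 729) hc₀]
  have hcS2 : 729 * c₀ ≤ cS := by rw [hcS]; linarith [mul_nonneg (by norm_num : (0:ℝ) ≤ 4374) hCs]
  have hcΛ1 : 1728 * (L : ℝ) * (2 * (L : ℝ) + 9) ^ 3 * Cs ≤ cΛ := by
    rw [hcΛ]; nlinarith [mul_nonneg (mul_nonneg (by norm_num : (0:ℝ) ≤ 288) hc₀) hL9]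
  have hcΛ2 : 288 * (L : ℝ) * (2 * (L : ℝ) + 9) ^ 3 * c₀ ≤ cΛ := by
    rw [hcΛ]; nlinarith [mul_nonneg (mul_nonneg (by norm_num : (0:ℝ) ≤ 1728) hCs) hL9]
  have hVc : (1 : ℝ) ≤ V := le_rfl
  have hV'c : 13068 * ((L : ℝ) + 4) ^ 2 ≤ V' := le_rfl
  have hcS0 : 0 ≤ cS := by rw [hcS]; positivity
  have hcΛ0 : 0 ≤ cΛ := by rw [hcΛ]; positivity
  have hV0 : 0 ≤ V := by rw [hV]; positivity
  have hV'0 : 0 ≤ V' := by rw [hV']; positivity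
  have hNlr : (1 : ℝ) ≤ Nl := by exact_mod_cast hNl
  -- the currencies
  set MX : ℝ := ∑ y : Fin d → Fin N0, ∑ ν : Fin d, ‖Xf (boxVec N0 y) ν‖ ^ 2 with hMX'
  set GX : ℝ := ∑ y : Fin d → Fin N0, ∑ ν : Fin d, ∑ μ : Fin d, (‖Xf (boxVec N0 y + e μ) ν‖ - ‖Xf (boxVec N0 y) ν‖) ^ 2 with hGX'
  have hMX0 : 0 ≤ MX := by positivity
  have hGX0 : 0 ≤ GX := by positivity
  set MASS : ℕ → ℝ := fun j => ∑ y : Fin d → Fin (Nj j), ∑ ν : Fin d, ‖Yj j (boxVec (Nj j) y) ν‖ ^ 2 with hMASS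
  set GAP : ℕ → ℝ := fun j =>
      ∑ y : Fin d → Fin (Nj j), ∑ ν : Fin d, ∑ μ : Fin d, (‖Yj j (boxVec (Nj j) y + e μ) ν‖ - ‖Yj j (boxVec (Nj j) y) ν‖) ^ 2 with hGAP
  have hMASS0 : ∀ j, j < l → 0 ≤ MASS j := fun j _ => by positivity
  -- the rows as reals
  set S : ℕ → ℝ := fun j => E * (((L : ℝ) ^ 2) ^ (l - 1 - j))⁻¹ * cS * MASS j with hS
  set Λ : ℕ → ℝ := fun j => ∑ i ∈ Finset.range (l - 1 - j), E * (((L : ℝ) ^ 2) ^ i)⁻¹ * cΛ *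
      (V * ((L : ℝ) ^ 3) ^ (i + 1) * (((L : ℝ) ^ 3) ^ (l - 1 - j + 1))⁻¹ * MASS j + V' * ((L : ℝ) ^ 2) ^ (i + 1) * GAP j) with hΛ
  set Z₀ : ℝ := E * (((L : ℝ) ^ 2) ^ l)⁻¹ * cS * MX + ∑ i ∈ Finset.range l, E * (((L : ℝ) ^ 2) ^ i)⁻¹ * cΛ *
      (V * ((L : ℝ) ^ 3) ^ (i + 1) * (((L : ℝ) ^ 3) ^ (l + 1))⁻¹ * MX + V' * ((L : ℝ) ^ 2) ^ (i + 1) * GX) with hZ₀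
  -- §2 on the level-0 term
  have h0 : ∑ z ∈ box c (R : ℤ), ∑ κ : Fin d, ‖Q0 l Y0 z κ‖ ≤ Z₀ := by
    have h := sum_norm_linTower_sq_le_rows hd L hL U₀ l hV₀ α₀ hα₀0 hα₀ hα₀24 Y0 Q0 hQ00 hQ0s Xf hc₀ hY0 N0 hper0 Nl hN0 c R hR hE
      hprod₀ hcS2 hcΛ2 hVc hV'c
    simpa only [hZ₀, hMX', hGX'] using h
  -- §1 on each source level
  have hj : ∀ j ∈ Finset.range l, ∑ z ∈ box c (R : ℤ), ∑ κ : Fin d, ‖Qj j (l - 1 - j) (sj j) z κ‖ ≤ S j + Λ j := by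
    intro j hjm
    have hjl : j < l := Finset.mem_range.mp hjm
    have h := sum_norm_linTower_tied_le_rows hd L hL (Ub j) (l - 1 - j) (hVj j hjl) (αj j) (hαj0 j) (hαj j hjl) (hαj24 j hjl)
      (sj j) (Qj j) (hQj0 j) (hQjs j hjl) (Yj j) hCs (hsj j hjl) (Nj j) (hperj j hjl) Nl (hNj j hjl) c R hR hE (hprodj j hjl)
      hcS1 hcΛ1 hVc hV'c
    simpa only [hS, hΛ, hMASS, hGAP] using h
  -- the real assembly
  have hreal := h21E_real_assembly (L : ℝ) hLr l hE hcS0 hcΛ0 hV0 hV'0 hAm hBm hBg hMX0 hGX0 S Λ MASS GAP hMASS0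
    (fun j hjl => hMc j hjl) (fun j hjl => hGc j hjl) (fun j _ => le_rfl) (fun j _ => le_rfl) (Z₀ := Z₀) le_rfl
  -- collect
  have hsum : ∑ j ∈ Finset.range l, ∑ z ∈ box c (R : ℤ), ∑ κ : Fin d, ‖Qj j (l - 1 - j) (sj j) z κ‖ ≤ ∑ j ∈ Finset.range l, (S j + Λ j) :=
    Finset.sum_le_sum hj
  have hmain : ∑ z ∈ box c (R : ℤ), ∑ κ : Fin d, ‖El z κ‖ ≤
      E * (cS + cΛ * V / ((L : ℝ) - 1)) * (Am * ((L : ℝ) ^ 2 / ((L : ℝ) - 1)) + MX) * ((L : ℝ) ^ l)⁻¹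
        + (E * (cS + cΛ * V / ((L : ℝ) - 1)) * Bm * ((L : ℝ) ^ 2 / ((L : ℝ) ^ 3 - 1)) + E * cΛ * V' * (L : ℝ) ^ 2 * (Bg / ((L : ℝ) - 1) ^ 2 + GX)) * (L : ℝ) ^ l :=
    by linarith [hDuh, h0, hsum, hreal]
  -- monotonicity in the level-0 currencies `MX ≤ M`, `GX ≤ G₀`
  have hK0 : 0 ≤ E * (cS + cΛ * V / ((L : ℝ) - 1)) := by
    have : 0 ≤ cΛ * V / ((L : ℝ) - 1) := div_nonneg (mul_nonneg hcΛ0 hV0) (by linarith)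
    positivity
  have hLl : 0 ≤ ((L : ℝ) ^ l)⁻¹ := by positivity
  have hLl' : 0 ≤ (L : ℝ) ^ l := by positivity
  have p1 : E * (cS + cΛ * V / ((L : ℝ) - 1)) * (Am * ((L : ℝ) ^ 2 / ((L : ℝ) - 1)) + MX) * ((L : ℝ) ^ l)⁻¹
      ≤ E * (cS + cΛ * V / ((L : ℝ) - 1)) * (Am * ((L : ℝ) ^ 2 / ((L : ℝ) - 1)) + M) * ((L : ℝ) ^ l)⁻¹ :=
    mul_le_mul_of_nonneg_right (mul_le_mul_of_nonneg_left (by linarith [hMX]) hK0) hLl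
  have hK1 : 0 ≤ E * cΛ * V' * (L : ℝ) ^ 2 := by positivity
  have p2 : (E * (cS + cΛ * V / ((L : ℝ) - 1)) * Bm * ((L : ℝ) ^ 2 / ((L : ℝ) ^ 3 - 1)) + E * cΛ * V' * (L : ℝ) ^ 2 * (Bg / ((L : ℝ) - 1) ^ 2 + GX)) * (L : ℝ) ^ l
      ≤ (E * (cS + cΛ * V / ((L : ℝ) - 1)) * Bm * ((L : ℝ) ^ 2 / ((L : ℝ) ^ 3 - 1)) + E * cΛ * V' * (L : ℝ) ^ 2 * (Bg / ((L : ℝ) - 1) ^ 2 + G₀)) * (L : ℝ) ^ l :=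
    mul_le_mul_of_nonneg_right (by linarith [mul_le_mul_of_nonneg_left (show Bg / ((L : ℝ) - 1) ^ 2 + GX ≤ Bg / ((L : ℝ) - 1) ^ 2 + G₀ by linarith [hGX]) hK1]) hLl'
  have hfin := hmain.trans (add_le_add p1 p2)
  simpa only [hcS, hcΛ, hV, hV'] using hfin


end Summit.QuantumFields.YangMills.Theorems.Prop7CornerCombH21EOfRows

end
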